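import Summits.BirchSwinnertonDyer.BirchSwinnertonDyer.Theorems.ResidualThetaTransportAtTwoThetaLayerLambdaCongruenceAtTwoCruxOfCuspSpan
import Summits.BirchSwinnertonDyer.BirchSwinnertonDyer.Theorems.ResidualThetaTransportAtTwoSignedMuVanishingAtTwoPlusAnalyticChild
import HarnessLib

/-!
# Route `ResidualThetaTransportAtTwo`: ONE per-curve research node for BOTH supersingular-at-2 cruxes — (μ-W₀)/(PR₂)
# «the undepleted plus symbol of `W`'s newform is `2`-adically maximal at a `2`-power cusp of some even layer» gives crux Kan⁺
# `ThetaLayerLambdaCongruenceAtTwo` (stmt-BirchSwinnertonDyer-20688, with the plus-line facts + Deligne) AND crux Kμ⁺'s analytic child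
# `SignedMuAnalyticAtTwoPlus` (stmt-BirchSwinnertonDyer-21437, with Abbes–Ullmo) — width seat bsd-wall-rtt-p3-w3 g4
# (`--supports stmt-BirchSwinnertonDyer-20688 --as helper`; closes nothing)

HONEST FRAMING. THEOREMS ONLY (compositions); every research / Literature input is an explicit hypothesis; nothing about any curve or
form is asserted; BSD is not proved by this.

* `flatMuZeroAtTwo_of_undepletedMax` — (PR₂) on the habitat⁺ ⟹ Kμ⁺'s registered stub statement FLAT («`2 ∤ L⁻` for every Pollack
  pair of the newform of every habitat⁺ curve», the binder `hflat` of `Theorems.signedMuAnalyticAtTwoPlus_of_abbesUllmo_of_flatMuZero`,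
  verbatim) — from `flatAtTwo_of_undepletedMax` (`…CruxOfCuspSpan`, p610964).
* `signedMuAnalyticAtTwoPlus_of_abbesUllmo_of_undepletedMax` — Abbes–Ullmo Thm A (named fact) + (PR₂) ⟹ the crux child
  `SignedMuAnalyticAtTwoPlus` (21437) BY NAME.
* `thetaLayerLambdaCongruence_and_signedMuAnalytic_of_facts_undepletedMax` — the plus-line facts + Deligne + Abbes–Ullmo + (PR₂) ⟹
  Kan⁺ ∧ (Kμ⁺ analytic child), both BY NAME: the single conjecture-grade statement (PR₂) (= (μ-W₀), the registered research stub of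
  line `birth`, skeleton v11; implied by `SignedMuAtTwo.CuspSpanEvenAtTwo N_W`, p609376) is what separates BOTH cruxes from print.

References: [Pollack2003] Conj. 6.3, Prop. 6.18; [AbbesUllmo1996] Thm. A; [PollackWeston2011MT] Rem. 4.2.
-/

noncomputable section

-- justification: the `Summit.BirchSwinnertonDyer.BirchSwinnertonDyer.…` path repeats a component (route-file convention)
set_option linter.dupNamespace false

open Literature.NumberTheory.EllipticCurves Literature.NumberTheory.EllipticCurves.ModularForms
  Summit.BirchSwinnertonDyer.Rank1Residual.Supersingular

namespace Summit.BirchSwinnertonDyer.BirchSwinnertonDyer.Theorems.ThetaLayerLambdaCongruenceAtTwo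

/-- **(PR₂) on the habitat⁺ ⟹ FLAT** (Kμ⁺'s stub statement, verbatim binder of `Theorems.signedMuAnalyticAtTwoPlus_of_abbesUllmo_of_flatMuZero`):
`2 ∤ L⁻` for every Pollack pair of the newform of every habitat⁺ curve. [cite: Pollack2003, Conj. 6.3 and Prop. 6.18] -/
theorem flatMuZeroAtTwo_of_undepletedMax
    (hPR : ∀ (W : WeierstrassCurve ℚ) [W.IsElliptic] [W.IsGloballyMinimal], ¬ W.HasCM → W.analyticRank = 0 → Literature.NumberTheory.EllipticCurves.Rank1Residual.GoodSS W 2 → W.frobeniusTrace 2 = 0 → W.Δ < 0 → ∀ [NeZero (W.conductorNorm ℤ)] (f : CuspForm (CongruenceSubgroup.Gamma0 (W.conductorNorm ℤ)) 2), Literature.NumberTheory.EllipticCurves.ModularForms.IsNewformOf W f → ∃ n₁ : ℕ, Even n₁ ∧ ∃ s : ZMod (2 ^ n₁), ∀ r : ℚ, ‖algebraMap ℚ (PadicAlgCl 2) (ratPlusSymbol f r)‖ ≤ ‖algebraMap ℚ (PadicAlgCl 2) (ratPlusSymbol f ((((Literature.NumberTheory.EllipticCurves.cyclotomicGenerator 2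 : ZMod (2 ^ (n₁ + 2))) ^ s.val).val : ℚ) / (2 : ℚ) ^ (n₁ + 2)))‖) :
    ∀ (W : WeierstrassCurve ℚ) [W.IsElliptic] [W.IsGloballyMinimal], ¬ W.HasCM →
      W.analyticRank = 0 → Literature.NumberTheory.EllipticCurves.Rank1Residual.GoodSS W 2 → W.frobeniusTrace 2 = 0 → W.Δ < 0 →
      ∀ [NeZero (W.conductorNorm ℤ)] (f : CuspForm (CongruenceSubgroup.Gamma0 (W.conductorNorm ℤ)) 2), IsNewformOf W f →
      ∀ (Lplus Lminus : IwasawaAlgebra 2), IsPollackPair f 2 Lplus Lminus → ¬ PowerSeries.C (2 : ℤ_[2]) ∣ Lminus := by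
  intro W _ _ hcm hr hss ha hΔ _ f hf
  exact flatAtTwo_of_undepletedMax hf (hPR W hcm hr hss ha hΔ f hf)

/-- **Abbes–Ullmo + (PR₂) ⟹ crux Kμ⁺'s analytic child `SignedMuAnalyticAtTwoPlus` (stmt-BirchSwinnertonDyer-21437) BY NAME**
(`Theorems.signedMuAnalyticAtTwoPlus_of_abbesUllmo_of_flatMuZero` ∘ `flatMuZeroAtTwo_of_undepletedMax`).  Conditional on the
named fact (Abbes–Ullmo 1996 Thm A) and on the conjecture-grade (PR₂); BSD is not proved by this. [cite: AbbesUllmo1996, Thm. A]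
[cite: Pollack2003, Prop. 6.18] -/
theorem signedMuAnalyticAtTwoPlus_of_abbesUllmo_of_undepletedMax
    (hAU : abbesUllmo_not_dvd_maninConstant_of_not_dvd_level)
    (hPR : ∀ (W : WeierstrassCurve ℚ) [W.IsElliptic] [W.IsGloballyMinimal], ¬ W.HasCM → W.analyticRank = 0 → Literature.NumberTheory.EllipticCurves.Rank1Residual.GoodSS W 2 → W.frobeniusTrace 2 = 0 → W.Δ < 0 → ∀ [NeZero (W.conductorNorm ℤ)] (f : CuspForm (CongruenceSubgroup.Gamma0 (W.conductorNorm ℤ)) 2), Literature.NumberTheory.EllipticCurves.ModularForms.IsNewformOf W f → ∃ n₁ : ℕ, Even n₁ ∧ ∃ s : ZMod (2 ^ n₁), ∀ r : ℚ, ‖algebraMap ℚ (PadicAlgCl 2) (ratPlusSymbol f r)‖ ≤ ‖algebraMap ℚ (PadicAlgCl 2) (ratPlusSymbol f ((((Literature.NumberTheory.EllipticCurves.cyclotomicGenerator 2 : ZMod (2 ^ (n₁ + 2))) ^ s.val).val : ℚ) / (2 : ℚ) ^ (n₁ + 2)))‖) :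
    Summit.BirchSwinnertonDyer.BirchSwinnertonDyer.Theses.ResidualThetaTransportAtTwo.SignedMuAnalyticAtTwoPlus :=
  Summit.BirchSwinnertonDyer.BirchSwinnertonDyer.Theorems.signedMuAnalyticAtTwoPlus_of_abbesUllmo_of_flatMuZero hAU
    (flatMuZeroAtTwo_of_undepletedMax hPR)

/-- **ONE conjecture-grade node for both cruxes.**  The six plus-line facts + Deligne + Abbes–Ullmo (all printed, by name) + (PR₂) ⟹
crux Kan⁺ `ThetaLayerLambdaCongruenceAtTwo` (20688) ∧ crux Kμ⁺'s analytic child `SignedMuAnalyticAtTwoPlus` (21437), BOTH BY NAME.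
BSD is not proved by this. [cite: Pollack2003, Conj. 6.3] [cite: AbbesUllmo1996, Thm. A] [cite: PollackWeston2011MT, Rem. 4.2.1] -/
theorem thetaLayerLambdaCongruence_and_signedMuAnalytic_of_facts_undepletedMax
    (hES : eichlerShimura_depletedOptimalQuotient_periodLattice_of_dvd)
    (hF : WeierstrassCurve.isIsogenous_iff_frobeniusTrace_eq) (hMK : mazurKenku_exists_cyclic_isogeny)
    (hSD : heckeSelfDual_torsionBy_J0) (hBz : buzzard2000_multiplicityOne_gamma0)
    (hSe : serre1972_supersingular_decompositionSubgroup_image)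
    (hD : Deligne1974_heckeT_eigenvalue_norm_le) (hAU : abbesUllmo_not_dvd_maninConstant_of_not_dvd_level)
    (hPR : ∀ (W : WeierstrassCurve ℚ) [W.IsElliptic] [W.IsGloballyMinimal], ¬ W.HasCM → W.analyticRank = 0 → Literature.NumberTheory.EllipticCurves.Rank1Residual.GoodSS W 2 → W.frobeniusTrace 2 = 0 → W.Δ < 0 → ∀ [NeZero (W.conductorNorm ℤ)] (f : CuspForm (CongruenceSubgroup.Gamma0 (W.conductorNorm ℤ)) 2), Literature.NumberTheory.EllipticCurves.ModularForms.IsNewformOf W f → ∃ n₁ : ℕ, Even n₁ ∧ ∃ s : ZMod (2 ^ n₁), ∀ r : ℚ, ‖algebraMap ℚ (PadicAlgCl 2) (ratPlusSymbol f r)‖ ≤ ‖algebraMap ℚ (PadicAlgCl 2) (ratPlusSymbol f ((((Literature.NumberTheory.EllipticCurves.cyclotomicGenerator 2 : ZMod (2 ^ (n₁ + 2))) ^ s.val).val : ℚ) / (2 : ℚ) ^ (n₁ + 2)))‖) :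
    Summit.BirchSwinnertonDyer.BirchSwinnertonDyer.Theses.ResidualThetaTransportAtTwo.ThetaLayerLambdaCongruenceAtTwo ∧
      Summit.BirchSwinnertonDyer.BirchSwinnertonDyer.Theses.ResidualThetaTransportAtTwo.SignedMuAnalyticAtTwoPlus :=
  ⟨thetaLayerLambdaCongruenceAtTwo_of_facts_undepletedMax_deligne hES hF hMK hSD hBz hSe hPR hD,
    signedMuAnalyticAtTwoPlus_of_abbesUllmo_of_undepletedMax hAU hPR⟩

end Summit.BirchSwinnertonDyer.BirchSwinnertonDyer.Theorems.ThetaLayerLambdaCongruenceAtTwo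

end
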